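import Literature.AnabelianGeometry.SemiGraphs.TemperedHostEdgeEndsOfSaturated
import Literature.AnabelianGeometry.SemiGraphs.TemperedEdgeLikeCentralizerOfTopCyclic
import HarnessLib

/-!
# [SemiAnbd] Cor 3.9 (R3c) `EdgeLikeCentralizerAt` for ARBITRARY edge groups under SATURATION of the open
# edge pieces — a class-free criterion at every chart (proof-only)

Mochizuki, *Semi-graphs of anabelioids*, Publ. RIMS **42** (2006), §3, Corollary 3.9, proof p. 43 l. 13
("[again by Theorem 3.7, (iii), (iv)]" — the cell's step (R3c), FACT-LIST rows F-2772
`EdgeLikeCentralizerAt` / F-2773 `EdgeLikeCentralizer`) [cite: MochizukiSemiAnbd2006, Cor 3.9 p.43].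

PROOF-ONLY (cell abc-iut, block F, seat abc-iut-f-176 gen 5; the CLASS-FREE form of abc-iut-f-172 gen 7's
closer file p493572 `TemperedEdgeLikeCentralizerOfTopCyclic`; no definition, no named fact).  The chain
p497198 (A^sat) → p497839 (B^sat) → `TemperedFirstBranchAtHostOfSaturated` → `TemperedHostEdgeEndsOfSaturated`
replaces the ONE use of «all edge groups topologically cyclic» in abc-iut-f-172's (R3c) chain by SATURATION
(«every `C`-fixed tree edge of `𝔾̃_n` whose stabiliser element dies at the reference level `j ≥ j₀` has that
element in `ρ_n(C)`»; size reading: every level-`n` host of `C` grows exactly as fast as `C` above `j₀`).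
* `dist_le_four_of_fixed_pair_of_eventually_saturated` — `hbdd` with bound `4` at every level;
* `centralizer_le_verticial_of_saturated` — canonical chart: for a compact `C ≠ 1` fixing the host edges
  `Q.edge n` and eventually saturated, `centralizer C ≤ H` for EVERY verticial `H ⊇ C`
  (abc-iut-f-172 gen 4's `mem_verticial_of_centralizer_of_bounded_displacement`);
* `edgeLikeCentralizerAt_of_saturated` — **F-2772 `EdgeLikeCentralizerAt ℋ c` at EVERY chart of every
  graph of anabelioids satisfying the hypotheses of Cor. 3.9 in which every open edge piece `ψ₀(U)` (at the
  canonical chart) is EVENTUALLY SATURATED** — arbitrary edge groups, arbitrary underlying graph.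
Together with p493572 the bare ∀ F-2773 is thereby reduced to graphs exhibiting a `C`-fixed tree edge whose
host is NEITHER topologically cyclic NOR saturated (a level-`n` host growing strictly faster than `C` above
every `j₀`, e.g. a ℤ_p-anchor hosted in ℤ_p²-cores, or torsion hosts ℤ_p × ℤ/p).

Honest framing: one sufficient condition; the ∀-closures F-2773 / F-1732 are NOT claimed; nothing here
bears on [IUTchIII] Cor. 3.12; typed ≠ proved elsewhere.
-/

namespace Literature.AnabelianGeometry.SemiGraphs

namespace ProfiniteSemiGraph

open CategoryTheory Topology

universe u

variable (𝒢 : ProfiniteSemiGraph.{u}) (h37 : 𝒢.Thm37Hypotheses)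

/-- **`hbdd` with bound `4` at EVERY level from eventual saturation.**
[cite: MochizukiSemiAnbd2006, Thm 3.7(iii) p.41] -/
theorem dist_le_four_of_fixed_pair_of_eventually_saturated
    (C : Subgroup (𝒢.temperedPiChart h37.toProp36Hypotheses).G) (hC : C ≠ ⊥) {e₀ : 𝒢.graph.Edge}
    (Q : (𝒢.galoisLevelData h37.toProp36Hypotheses).EdgeSeq h37.toProp36Hypotheses.isCountable e₀)
    (hQ : ∀ g ∈ C, ∀ n, ((𝒢.galoisLevelData h37.toProp36Hypotheses).treeAct
      h37.toProp36Hypotheses.isCountable n g).hom.edgeMap (Q.edge n) = Q.edge n)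
    {b₁ b₂ : 𝒢.graph.Branch} (hb12 : b₁ ≠ b₂) (hb₁e : 𝒢.graph.edgeOf b₁ = e₀)
    (hb₂e : 𝒢.graph.edgeOf b₂ = e₀) {v₁ v₂ : 𝒢.graph.Vertex} (hb₁ : 𝒢.graph.abuts b₁ = some v₁)
    (hb₂ : 𝒢.graph.abuts b₂ = some v₂)
    (x x' : ∀ n, ((𝒢.galoisLevelData h37.toProp36Hypotheses).tree n).Vertex)
    (hx : ∀ ⦃i n : ℕ⦄ (hin : i ≤ n),
      ((𝒢.galoisLevelData h37.toProp36Hypotheses).treeTrans hin).vertexMap (x n) = x i)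
    (hx' : ∀ ⦃i n : ℕ⦄ (hin : i ≤ n),
      ((𝒢.galoisLevelData h37.toProp36Hypotheses).treeTrans hin).vertexMap (x' n) = x' i)
    (hfx : ∀ g ∈ C, ∀ n, ((𝒢.galoisLevelData h37.toProp36Hypotheses).treeAct
      h37.toProp36Hypotheses.isCountable n g).hom.vertexMap (x n) = x n)
    (hfx' : ∀ g ∈ C, ∀ n, ((𝒢.galoisLevelData h37.toProp36Hypotheses).treeAct
      h37.toProp36Hypotheses.isCountable n g).hom.vertexMap (x' n) = x' n) (j₀ : ℕ)
    (hsat : ∀ (j : ℕ), j₀ ≤ j → ∀ (n : ℕ) (hjn : j ≤ n) (γ : ((𝒢.galoisLevelData h37.toProp36Hypotheses).tree n).Branch),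
      (∀ g ∈ C, ((𝒢.galoisLevelData h37.toProp36Hypotheses).treeAct h37.toProp36Hypotheses.isCountable n g).hom.edgeMap (((𝒢.galoisLevelData h37.toProp36Hypotheses).tree n).edgeOf γ) =
        ((𝒢.galoisLevelData h37.toProp36Hypotheses).tree n).edgeOf γ) →
      ∀ q : (𝒢.galoisLevelData h37.toProp36Hypotheses).Gal h37.toProp36Hypotheses.isCountable n, (𝒢.galoisLevelData h37.toProp36Hypotheses).mapLE h37.toProp36Hypotheses.isCountable hjn q = 1 →
        ((𝒢.galoisLevelData h37.toProp36Hypotheses).galTreeAct h37.toProp36Hypotheses.isCountable n q).hom.edgeMap (((𝒢.galoisLevelData h37.toProp36Hypotheses).tree n).edgeOf γ) =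
          ((𝒢.galoisLevelData h37.toProp36Hypotheses).tree n).edgeOf γ →
        q ∈ C.map ((𝒢.galoisLevelData h37.toProp36Hypotheses).proj h37.toProp36Hypotheses.isCountable n))
    (j : ℕ) :
    ((𝒢.galoisLevelData h37.toProp36Hypotheses).tree j).subdivision.dist (Sum.inl (x j)) (Sum.inl (x' j)) ≤ 4 := by
  obtain ⟨δ, hδe, hδa⟩ := 𝒢.exists_branch_edge_abuts_of_fixed_of_eventually_saturated h37 C hC Q hQ hb12 hb₁e
    hb₂e hb₁ hb₂ x hx hfx j₀ hsat j
  obtain ⟨δ', hδ'e, hδ'a⟩ := 𝒢.exists_branch_edge_abuts_of_fixed_of_eventually_saturated h37 C hC Q hQ hb12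
    hb₁e hb₂e hb₁ hb₂ x' hx' hfx' j₀ hsat j
  obtain ⟨a', hends, hdist⟩ := SemiGraph.exists_ends_dist_le_four (Q.edge j) δ hδe hδa
  rcases hends δ' (x' j) hδ'e hδ'a with h | h
  · rw [h, SimpleGraph.dist_self]; exact Nat.zero_le _
  · rw [h]; exact hdist

/-- **The centraliser lies in every verticial host — arbitrary edge groups, eventual saturation** (canonical
chart).  For `𝒢` satisfying the hypotheses of Thm. 3.7, a compact `C ≠ 1` fixing the tree edges `Q.edge n` of
an edge-point sequence `Q` over a base edge `e₀` with branches `b₁ ≠ b₂` at `v₁`, `v₂`, saturated relative to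
every reference level `j ≥ j₀`, and ANY verticial `H ⊇ C`: `centralizer C ≤ H` — the pair `(y, g·y)` stays at
distance `≤ 4` (`dist_le_four_of_fixed_pair_of_eventually_saturated`), then abc-iut-f-172 gen 4's
`mem_verticial_of_centralizer_of_bounded_displacement`. [cite: MochizukiSemiAnbd2006, Cor 3.9 p.43] -/
theorem centralizer_le_verticial_of_saturated
    (C : Subgroup (𝒢.temperedPiChart h37.toProp36Hypotheses).G)
    (hCc : IsCompact (C : Set (𝒢.temperedPiChart h37.toProp36Hypotheses).G)) (hC : C ≠ ⊥)
    {e₀ : 𝒢.graph.Edge}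
    (Q : (𝒢.galoisLevelData h37.toProp36Hypotheses).EdgeSeq h37.toProp36Hypotheses.isCountable e₀)
    (hQ : ∀ g ∈ C, ∀ n, ((𝒢.galoisLevelData h37.toProp36Hypotheses).treeAct
      h37.toProp36Hypotheses.isCountable n g).hom.edgeMap (Q.edge n) = Q.edge n)
    {b₁ b₂ : 𝒢.graph.Branch} (hb12 : b₁ ≠ b₂) (hb₁e : 𝒢.graph.edgeOf b₁ = e₀)
    (hb₂e : 𝒢.graph.edgeOf b₂ = e₀) {v₁ v₂ : 𝒢.graph.Vertex} (hb₁ : 𝒢.graph.abuts b₁ = some v₁)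
    (hb₂ : 𝒢.graph.abuts b₂ = some v₂) (j₀ : ℕ)
    (hsat : ∀ (j : ℕ), j₀ ≤ j → ∀ (n : ℕ) (hjn : j ≤ n) (γ : ((𝒢.galoisLevelData h37.toProp36Hypotheses).tree n).Branch),
      (∀ g ∈ C, ((𝒢.galoisLevelData h37.toProp36Hypotheses).treeAct h37.toProp36Hypotheses.isCountable n g).hom.edgeMap (((𝒢.galoisLevelData h37.toProp36Hypotheses).tree n).edgeOf γ) =
        ((𝒢.galoisLevelData h37.toProp36Hypotheses).tree n).edgeOf γ) →
      ∀ q : (𝒢.galoisLevelData h37.toProp36Hypotheses).Gal h37.toProp36Hypotheses.isCountable n, (𝒢.galoisLevelData h37.toProp36Hypotheses).mapLE h37.toProp36Hypotheses.isCountable hjn q = 1 →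
        ((𝒢.galoisLevelData h37.toProp36Hypotheses).galTreeAct h37.toProp36Hypotheses.isCountable n q).hom.edgeMap (((𝒢.galoisLevelData h37.toProp36Hypotheses).tree n).edgeOf γ) =
          ((𝒢.galoisLevelData h37.toProp36Hypotheses).tree n).edgeOf γ →
        q ∈ C.map ((𝒢.galoisLevelData h37.toProp36Hypotheses).proj h37.toProp36Hypotheses.isCountable n))
    {v : 𝒢.graph.Vertex} {H : Subgroup (𝒢.temperedPiChart h37.toProp36Hypotheses).G}
    (hH : H ∈ verticialSubgroups (𝒢.temperedPiChart h37.toProp36Hypotheses) v) (hCH : C ≤ H) :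
    Subgroup.centralizer (C : Set (𝒢.temperedPiChart h37.toProp36Hypotheses).G) ≤ H := by
  intro g hg
  obtain ⟨y, hyc, hyH⟩ := 𝒢.exists_fixed_system_of_mem_verticialSubgroups h37 hH
  have hcomm : ∀ k ∈ C, k * g = g * k := fun k hk => Subgroup.mem_centralizer_iff.mp hg k hk
  have hyC : ∀ k ∈ C, ∀ j,
      ((verticialLevelData_temperedPiChart (h36 := h37.toProp36Hypotheses)).act j k).hom.vertexMap (y j) =
        y j := fun k hk j => hyH k (hCH hk) j
  have hy₁c := (verticialLevelData_temperedPiChart (h36 := h37.toProp36Hypotheses)).translate_compat' g hyc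
  have hy₁C := (verticialLevelData_temperedPiChart (h36 := h37.toProp36Hypotheses)).translate_fixed' hcomm hyC
  exact 𝒢.mem_verticial_of_centralizer_of_bounded_displacement h37 C hCc hC hH hCH y hyc hyH g hg
    ⟨4, fun j => 𝒢.dist_le_four_of_fixed_pair_of_eventually_saturated h37 C hC Q hQ hb12 hb₁e hb₂e hb₁ hb₂ y
      (fun j => ((verticialLevelData_temperedPiChart (h36 := h37.toProp36Hypotheses)).act j g).hom.vertexMap
        (y j)) hyc hy₁c hyC hy₁C j₀ hsat j⟩

variable {𝒢} {ℋ : ProfiniteSemiGraph.{u}}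

/-- **(R3c) F-2772 `EdgeLikeCentralizerAt ℋ c` at EVERY chart, ARBITRARY edge groups, under EVENTUAL
SATURATION of the open edge pieces** — for a graph of anabelioids `ℋ` satisfying the hypotheses of
[SemiAnbd] Cor. 3.9 (any underlying graph) such that, at the canonical chart, for every edge homomorphism
`ψ₀` at an edge `e` and every open `U ≤ Π_e` the piece `ψ₀(U)` is saturated relative to all reference levels
`j ≥ j₀(e, ψ₀, U)`.  The open piece `ψ(U)` at the chart `c` is compact and nontrivial
(`isCompact_map_and_ne_bot_of_isEdgeHom`); transported to the canonical chart along
`TemperedPiChart.exists_compatIso` it is the piece `(ψ' ∘ ψ)(U)` of the edge homomorphism `ψ' ∘ ψ`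
(`isEdgeHom_comp_of_compat`), it lies in an edge-like subgroup and so fixes the tree edges of an edge-point
sequence (`exists_edgeSeq_fixing_of_le_of_mem_edgeLikeSubgroups`), and
`centralizer_le_verticial_of_saturated` applies. [cite: MochizukiSemiAnbd2006, Cor 3.9 p.43] -/
theorem edgeLikeCentralizerAt_of_saturated (hℋ : Cor39Hypotheses ℋ)
    (hsat : ∀ (e : ℋ.graph.Edge) (ψ₀ : ℋ.Ge e →ₜ* (ℋ.temperedPiChart hℋ.thm37Hypotheses.toProp36Hypotheses).G),
      IsEdgeHom (ℋ.temperedPiChart hℋ.thm37Hypotheses.toProp36Hypotheses) e ψ₀ →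
      ∀ U : Subgroup (ℋ.Ge e), IsOpen (U : Set (ℋ.Ge e)) → ∃ j₀ : ℕ,
        ∀ (j : ℕ), j₀ ≤ j → ∀ (n : ℕ) (hjn : j ≤ n) (γ : ((ℋ.galoisLevelData hℋ.thm37Hypotheses.toProp36Hypotheses).tree n).Branch),
          (∀ g ∈ (U.map ψ₀.toMonoidHom), ((ℋ.galoisLevelData hℋ.thm37Hypotheses.toProp36Hypotheses).treeAct hℋ.thm37Hypotheses.toProp36Hypotheses.isCountable n g).hom.edgeMap
              (((ℋ.galoisLevelData hℋ.thm37Hypotheses.toProp36Hypotheses).tree n).edgeOf γ) = ((ℋ.galoisLevelData hℋ.thm37Hypotheses.toProp36Hypotheses).tree n).edgeOf γ) →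
          ∀ q : (ℋ.galoisLevelData hℋ.thm37Hypotheses.toProp36Hypotheses).Gal hℋ.thm37Hypotheses.toProp36Hypotheses.isCountable n, (ℋ.galoisLevelData hℋ.thm37Hypotheses.toProp36Hypotheses).mapLE hℋ.thm37Hypotheses.toProp36Hypotheses.isCountable hjn q = 1 →
            ((ℋ.galoisLevelData hℋ.thm37Hypotheses.toProp36Hypotheses).galTreeAct hℋ.thm37Hypotheses.toProp36Hypotheses.isCountable n q).hom.edgeMap (((ℋ.galoisLevelData hℋ.thm37Hypotheses.toProp36Hypotheses).tree n).edgeOf γ) =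
              ((ℋ.galoisLevelData hℋ.thm37Hypotheses.toProp36Hypotheses).tree n).edgeOf γ →
            q ∈ (U.map ψ₀.toMonoidHom).map ((ℋ.galoisLevelData hℋ.thm37Hypotheses.toProp36Hypotheses).proj hℋ.thm37Hypotheses.toProp36Hypotheses.isCountable n))
    (c : TemperedPiChart ℋ) : EdgeLikeCentralizerAt ℋ c := by
  intro e ψ hψ U hU v H hH hUH
  have h37 : ℋ.Thm37Hypotheses := hℋ.thm37Hypotheses
  obtain ⟨hCc, hC⟩ := isCompact_map_and_ne_bot_of_isEdgeHom hℋ c e ψ hψ U hU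
  -- the two branches of `e` and their vertices
  obtain ⟨b₁, b₂, hb12, hb₁e, hb₂e, -⟩ := ℋ.graph.two_branches e
  obtain ⟨w₁, hw₁⟩ := Option.isSome_iff_exists.mp (hℋ.isGraph.abuts_isSome b₁)
  obtain ⟨w₂, hw₂⟩ := Option.isSome_iff_exists.mp (hℋ.isGraph.abuts_isSome b₂)
  -- transport to the canonical chart `c₀`
  obtain ⟨φ, ψ', hψφ, hφψ, hφ, hψ'⟩ :=
    TemperedPiChart.exists_compatIso (ℋ.temperedPiChart h37.toProp36Hypotheses) c
  have hinj : Function.Injective ψ' := fun y₁ y₂ h => by rw [← hφψ y₁, ← hφψ y₂, h]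
  have hmapV : ∀ {w : ℋ.graph.Vertex} {K : Subgroup c.G}, K ∈ verticialSubgroups c w →
      K.map ψ'.toMonoidHom ∈ verticialSubgroups (ℋ.temperedPiChart h37.toProp36Hypotheses) w :=
    fun hK => (mem_verticialSubgroups_iff_map φ hφ ψ' hφψ hψ' _).mp hK
  have hL : ψ.range.map ψ'.toMonoidHom ∈
      edgeLikeSubgroups (ℋ.temperedPiChart h37.toProp36Hypotheses) (ℋ.graph.edgeOf b₁) := by
    rw [hb₁e]
    exact (mem_edgeLikeSubgroups_iff_map φ hφ ψ' hφψ hψ' _).mp ⟨ψ, hψ, rfl⟩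
  -- the transported piece is the open piece of the edge homomorphism `ψ' ∘ ψ` of the canonical chart
  have hψ₀ : IsEdgeHom (ℋ.temperedPiChart h37.toProp36Hypotheses) e (ψ'.comp ψ) :=
    isEdgeHom_comp_of_compat ψ' hψ' hψ
  have hCU : (U.map ψ.toMonoidHom).map ψ'.toMonoidHom = U.map (ψ'.comp ψ).toMonoidHom := by
    rw [Subgroup.map_map]
    rfl
  obtain ⟨j₀, hsatU⟩ := hsat e (ψ'.comp ψ) hψ₀ U hU
  have hC₀c : IsCompact ((U.map (ψ'.comp ψ).toMonoidHom :
      Subgroup (ℋ.temperedPiChart h37.toProp36Hypotheses).G) :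
        Set (ℋ.temperedPiChart h37.toProp36Hypotheses).G) := by
    rw [← hCU, Subgroup.coe_map]
    exact hCc.image ψ'.continuous
  have hC₀ : U.map (ψ'.comp ψ).toMonoidHom ≠ ⊥ := fun h0 =>
    hC ((Subgroup.map_eq_bot_iff_of_injective (U.map ψ.toMonoidHom) hinj).mp (hCU.trans h0))
  have hC₀L : U.map (ψ'.comp ψ).toMonoidHom ≤ ψ.range.map ψ'.toMonoidHom := by
    rw [← hCU]; exact Subgroup.map_mono (Subgroup.map_le_range _ _)
  -- the host edge-point sequence over `e = edgeOf b₁`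
  obtain ⟨Q, hQ⟩ := ℋ.exists_edgeSeq_fixing_of_le_of_mem_edgeLikeSubgroups h37 _ _ hw₁ hL hC₀L
  intro g hg
  have hg₀ : ψ' g ∈ Subgroup.centralizer (((U.map (ψ'.comp ψ).toMonoidHom :
      Subgroup (ℋ.temperedPiChart h37.toProp36Hypotheses).G)) :
        Set (ℋ.temperedPiChart h37.toProp36Hypotheses).G) := by
    refine Subgroup.mem_centralizer_iff.mpr ?_
    rintro _ ⟨k, hk, rfl⟩
    have hkg : ψ k * g = g * ψ k := Subgroup.mem_centralizer_iff.mp hg (ψ k) ⟨k, hk, rfl⟩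
    change ψ' (ψ k) * ψ' g = ψ' g * ψ' (ψ k)
    rw [← map_mul, ← map_mul, hkg]
  have hmem : ψ' g ∈ H.map ψ'.toMonoidHom :=
    ℋ.centralizer_le_verticial_of_saturated h37 _ hC₀c hC₀ Q hQ hb12 rfl (hb₂e.trans hb₁e.symm) hw₁ hw₂ j₀
      hsatU (hmapV hH) (by rw [← hCU]; exact Subgroup.map_mono hUH) hg₀
  obtain ⟨h, hh, hhg⟩ := hmem
  have hhg' : h = g := hinj hhg
  exact hhg' ▸ hh

end ProfiniteSemiGraph

end Literature.AnabelianGeometry.SemiGraphs
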